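import Literature.AnabelianGeometry.EtaleTheta.Discharge.Sec5ThetaSubquotientProjGaloisAtSettingQ
import Literature.AnabelianGeometry.EtaleTheta.ThetaSubquotientLevelN
import HarnessLib

/-!
# [EtTh] §5 p.327: a v2 `P`-term WITH THE TWO PINS `hPpre` / `hPproj_pin` at abc-iut-L2-t4's junction object `ofThetaSettingDataQ`
# (print's `Q` over `B^temp(Π^tp_X̲̲)⁰`), and the level-`N` stub — so the `(Q, P)`-binder kits discharge their pins on the v2 record (proof-only)

S. Mochizuki, *The étale theta function and its Frobenioid-theoretic manifestations*, Publ. RIMS **45** (2009), §5 p. 327 (PDF p. 101):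
"these subquotients determine subquotients `Aut_D(D) ↠ Aut^Θ_D(D)`; `(l·Δ_Θ)_D ⊆ Aut^Θ_D(D)`" [cite: MochizukiEtTh2009, §5 p.327 (PDF p.101)].

abc-iut cell, layer L2, seat abc-iut-w6-d079 (gen 6), row «(w4) V1→V2» tranche 1.  PROOF-ONLY (0 definitions).  abc-iut-L2-t9's print's-`Q` kit
`Sec5Prop55QPBindersAtSettingQ.lean` (p447951) and abc-iut-w4-d042's level-`N` projection-pin file `Sec5Thm56EndKnitLevelNProjPin.lean` (p444002)
derive every `(Q, P)`-binder of the Prop. 5.5 / Thm. 5.6 (i) end knits from TWO PIN EQUATIONS on an arbitrary `P` at `B_N^bs`: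
`hPpre : P.pre B_N^bs = (autPre q ι B_N^bs).comap (Aut_D(B_N^bs) → Aut(B_N^bs.obj))` and the cast-free
`hPproj_pin : ∀ (σ : P.pre B_N^bs) (τ : autPre q ι B_N^bs), mapAut σ = τ → P.proj B_N^bs σ = autProj q ι B_N^bs τ` — "pinned and not packaged"
because for the v1 record «no `P` TERM is constructed».  On the v2 record `ThetaSubquotientProjGalois` (p481123) a term EXISTS
(`Sec5ThetaSubquotientProjGaloisAtSettingQ.lean`); here it is exhibited TOGETHER WITH BOTH PINS, at every object (not only `B_N^bs`):

* **`ThetaFrobenioid.exists_thetaSubquotientProjGalois_pinned_ofThetaSettingDataQ`** — at the junction object `ofThetaSettingDataQ μ hC hS h R K' …`: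
  `∃ P : ThetaSubquotientProjGalois _ (IsGaloisObj ·.obj)`, `(∀ E, P.pre E = (autPre q ι E.obj).comap (mapAut E ι))` ∧
  `(∀ E σ τ, mapAut σ = τ → P.proj E σ = autProj q ι E.obj τ)` — in particular `hPpre` and `hPproj_pin` at `E := B_N^bs` hold BY CONSTRUCTION;
* `RigidData.nonempty_thetaSubquotientProjGalois_of_stub_eq_levelStub` — every §5 datum over `B^temp(Π)⁰` whose stub is abc-iut-w4-d042's level-`N`
  stub `RD.levelStub ιX` (= `thetaSubquotientStub (q_N) (ι_N)`, `q_N` onto: `qN_surjective`) carries a v2 term (the K4 end knits' carriers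
  `ofConnectedTemperoidData h (RD.levelStub ιX) …` included, by `rfl` on their stub).

HONEST FRAMING: statements about the cell's OWN typed records at abc-iut-L2-t9's carrier; nothing asserts that [EtTh]'s data exist for an actual
curve (`tf` abstract); [EtTh] is refereed; nothing here bears on [IUTchIII] Cor. 3.12 — no side taken; typed ≠ proved.
-/

noncomputable section

namespace Literature.AnabelianGeometry.EtaleTheta

open CategoryTheory Literature.AlgebraicGeometry.Frobenioids Literature.AnabelianGeometry.SemiGraphs
open Literature.AlgebraicGeometry.Frobenioids.QuasiTemperoid (stabilizerSubgroup)
open FrobenioidCyclotomicRigidity (ThetaSubquotientProj ThetaSubquotientProjGalois)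
open scoped IsMulCommutative

/-! ### 1. The level-`N` stub -/

namespace RigidData

universe u v u₁ v₁

variable {N : ℕ+} {l : ℕ} (RD : RigidData.{u} N l) {G : Type v} [Group G] [TopologicalSpace G] (ιX : RD.PiX ≃ₜ* G)
  {C : Type u₁} [Category.{v₁} C]

/-- **Level `N`**: every §5 datum `𝔉` over `B^temp(Π)⁰` with `𝔉.toThetaSubquotientStub = RD.levelStub ιX` (abc-iut-w4-d042; `q_N` is onto,
`qN_surjective`) carries a v2 term — abc-iut-w6-d079's `nonempty_thetaSubquotientProjGalois_of_stub_eq` at `(q_N, ι_N)`.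
[cite: MochizukiEtTh2009, §5 p.327 (PDF p.101)] -/
theorem nonempty_thetaSubquotientProjGalois_of_stub_eq_levelStub [RD.iotaN.range.Normal]
    (𝔉 : ThetaFrobenioid.{max v u} C (ConnectedPart (BTemp G)))
    (h𝔉 : 𝔉.toThetaSubquotientStub = RD.levelStub ιX) :
    Nonempty (ThetaSubquotientProjGalois 𝔉 fun E => IsGaloisObj E.obj) :=
  ThetaSubquotient.nonempty_thetaSubquotientProjGalois_of_stub_eq (RD.qN ιX) RD.iotaN (RD.qN_surjective ιX) 𝔉 h𝔉

end RigidData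

/-! ### 2. The junction object: a term with both pins -/

namespace ThetaFrobenioid

open ThetaSubquotient

universe v₀

variable {p : ℕ} [Fact p.Prime] {D : ThetaSetting p} {E : D.EtaleThetaData} {l : ℕ} {C : E.DoubleUnderline l}
  {e : D.toTemperedCurve.GroupLevelData} {N : ℕ+} (μ : D.CyclotomeMod l N) (hC : D.Compat) (hS : D.Sec2Hyps)
  {D₀ : Type} [Category.{v₀} D₀] {V : FrdIMonoidStub.{0}} {T₀ : RealifiedDivisorMonoids (D₀ := D₀) V}
  {VD : FrdICatStub.{1, 0, 0} (ConnectedPart (BTemp (C.temperedArithmeticGroup e).Pi))}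
  {tf : TemperedFrobenioid T₀ (ConnectedPart (BTemp (C.temperedArithmeticGroup e).Pi)) VD} {hZ : tf.monoidType = MonoidType.Z}
  {hP : ∀ A : (ConnectedPart (BTemp (C.temperedArithmeticGroup e).Pi))ᵒᵖ, IsPerfect (tf.Φ.carrier A)}
  {NH : Subgroup (Field.absoluteGaloisGroup D.K) → tf.category → ℕ+ → Prop} {A₀ : tf.category}
  {hA₀ : PreFrobenioid.IsFrobeniusTrivial tf.toElem A₀} {hA₀' : SemiGraphs.IsGaloisObj A₀.base.obj}
  {pullFrac : ∀ {A A' : (BiKummerSetting.mkOfConnectedTemperoid (C.temperedArithmeticGroup e) tf hZ hP NH A₀ hA₀ hA₀').C} (_ : A' ⟶ A),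
    (BiKummerSetting.mkOfConnectedTemperoid (C.temperedArithmeticGroup e) tf hZ hP NH A₀ hA₀ hA₀').biratUnits A →
      (BiKummerSetting.mkOfConnectedTemperoid (C.temperedArithmeticGroup e) tf hZ hP NH A₀ hA₀ hA₀').biratUnits A'}
  {θ : (BiKummerSetting.mkOfConnectedTemperoid (C.temperedArithmeticGroup e) tf hZ hP NH A₀ hA₀ hA₀').biratUnits
    (BiKummerSetting.mkOfConnectedTemperoid (C.temperedArithmeticGroup e) tf hZ hP NH A₀ hA₀ hA₀').Aodot}
  {Bl : (BiKummerSetting.mkOfConnectedTemperoid (C.temperedArithmeticGroup e) tf hZ hP NH A₀ hA₀ hA₀').C}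
  {Pl : (BiKummerSetting.mkOfConnectedTemperoid (C.temperedArithmeticGroup e) tf hZ hP NH A₀ hA₀ hA₀').FractionPair θ Bl}
  {Rl : (BiKummerSetting.mkOfConnectedTemperoid (C.temperedArithmeticGroup e) tf hZ hP NH A₀ hA₀ hA₀').NthRoot θ Pl C.lPNat pullFrac}
  (h : ModelFrobenioid.Hypotheses tf.divisorMonoid tf.ratFnFunctor)
  (R : (BiKummerSetting.mkOfConnectedTemperoid (C.temperedArithmeticGroup e) tf hZ hP NH A₀ hA₀ hA₀').NthRoot Rl.root Rl.pair N pullFrac)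
  (K' : Type) [Field K'] (constEmb : K'ˣ →* tf.biratUnitsModel R.BN) (constEmb_injective : Function.Injective constEmb)
  (hinvc : ∀ g : Aut R.AN.base,
    pull tf.divisorMonoid g.hom (ModelFrobenioid.div R.pair.num) = ModelFrobenioid.div R.pair.num)
  (hinvp : ∀ y : (C.thetaEnvData μ hC hS).PiX, y ∈ (C.thetaEnvData μ hC hS).PiYdd →
    pull tf.divisorMonoid ((BiKummerSetting.mkOfConnectedTemperoid (C.temperedArithmeticGroup e) tf hZ hP NH A₀ hA₀ hA₀').galoisSurj
      R.AN.base R.αData.isGalois ((ContinuousMulEquiv.refl _) y)).hom (ModelFrobenioid.div R.pair.den) = ModelFrobenioid.div R.pair.den)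

/-- **A v2 `P`-term WITH BOTH PINS at the junction object** `ofThetaSettingDataQ μ hC hS h R K' …` (stub `ofSettingSub D l Π^tp_X̲̲`, definitionally):
`pre E := (autPre q ι E.obj).comap (mapAut E ι)` and `proj E σ := autProj q ι E.obj ⟨mapAut σ, _⟩` at EVERY object `E` — so abc-iut-w4-d042's /
abc-iut-L2-t9's pins `hPpre`, `hPproj_pin` (their exact shapes, at `E := B_N^bs` or any other object) hold BY CONSTRUCTION; surjective at Galois
objects by `autProj_surjective_at_galoisObj_of_range_le` (range condition = `map_toTheta_Huu`). [cite: MochizukiEtTh2009, §5 p.327 (PDF p.101)] -/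
theorem exists_thetaSubquotientProjGalois_pinned_ofThetaSettingDataQ :
    ∃ P : ThetaSubquotientProjGalois
        (ofThetaSettingDataQ μ hC hS h R K' constEmb constEmb_injective hinvc hinvp) fun E => IsGaloisObj E.obj,
      (∀ F : ConnectedPart (BTemp (C.temperedArithmeticGroup e).Pi),
          P.pre F = (autPre (qSub D C.Huu) (ιTheta D l) F.obj).comap
            (Functor.mapAut F (connectedObjects (BTemp (C.temperedArithmeticGroup e).Pi)).ι)) ∧
        ∀ (F : ConnectedPart (BTemp (C.temperedArithmeticGroup e).Pi)) (σ : P.pre F)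
          (τ : autPre (qSub D C.Huu) (ιTheta D l) F.obj),
          Functor.mapAut F (connectedObjects (BTemp (C.temperedArithmeticGroup e).Pi)).ι σ.1 = τ.1 →
            P.proj F σ = autProj (qSub D C.Huu) (ιTheta D l) F.obj τ := by
  have hq : (ιTheta D l).range ≤ (qSub D C.Huu).range :=
    range_ιTheta_le_range_qSub_of_le D l C.Huu fun x hx => by
      have hm := C.map_toTheta_Huu
      rw [← hm] at hx
      exact hx.1
  let ι' := (connectedObjects (BTemp (C.temperedArithmeticGroup e).Pi)).ι
  let pre : ∀ F : ConnectedPart (BTemp (C.temperedArithmeticGroup e).Pi), Subgroup (Aut F) := fun F =>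
    (autPre (qSub D C.Huu) (ιTheta D l) F.obj).comap (Functor.mapAut F ι')
  refine ⟨{ pre := pre
            proj := fun F => (autProj (qSub D C.Huu) (ιTheta D l) F.obj).comp
              (((Functor.mapAut F ι').restrict (pre F)).codRestrict (autPre (qSub D C.Huu) (ιTheta D l) F.obj) fun σ => σ.2)
            proj_surjective := fun F hF c => ?_ }, fun F => rfl, fun F σ τ hστ => ?_⟩
  · obtain ⟨σ₀, hσ₀⟩ := autProj_surjective_at_galoisObj_of_range_le (qSub D C.Huu) (ιTheta D l) hF hq c
    let eF : Aut F ≃* Aut F.obj := (connectedObjects (BTemp (C.temperedArithmeticGroup e).Pi)).fullyFaithfulι.autMulEquivOfFullyFaithful F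
    have hmem : eF.symm σ₀.1 ∈ pre F := by
      change (Functor.mapAut F ι') (eF.symm σ₀.1) ∈ autPre (qSub D C.Huu) (ιTheta D l) F.obj
      have : (Functor.mapAut F ι') (eF.symm σ₀.1) = eF (eF.symm σ₀.1) := rfl
      rw [this, MulEquiv.apply_symm_apply]
      exact σ₀.2
    refine ⟨⟨eF.symm σ₀.1, hmem⟩, ?_⟩
    rw [← hσ₀]
    change autProj (qSub D C.Huu) (ιTheta D l) F.obj ⟨eF (eF.symm σ₀.1), _⟩ = autProj (qSub D C.Huu) (ιTheta D l) F.obj σ₀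
    congr 1
  · change autProj (qSub D C.Huu) (ιTheta D l) F.obj ⟨Functor.mapAut F ι' σ.1, _⟩ = autProj (qSub D C.Huu) (ιTheta D l) F.obj τ
    congr 1
    exact Subtype.ext hστ

/-- In particular at `E := B_N^bs` (`R.BN.base`): the two pin equations `hPpre` / `hPproj_pin` of abc-iut-L2-t9's `Sec5Prop55QPBindersAtSettingQ` and
abc-iut-w4-d042's `Sec5Thm56EndKnitLevelNProjPin`, in their stated shapes, are satisfied by SOME v2 term.
[cite: MochizukiEtTh2009, §5 p.327 (PDF p.101)] -/
theorem exists_thetaSubquotientProjGalois_pins_at_BN_ofThetaSettingDataQ :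
    ∃ P : ThetaSubquotientProjGalois
        (ofThetaSettingDataQ μ hC hS h R K' constEmb constEmb_injective hinvc hinvp) fun E => IsGaloisObj E.obj,
      P.pre R.BN.base = (autPre (qSub D C.Huu) (ιTheta D l) R.BN.base.obj).comap
          (Functor.mapAut R.BN.base (connectedObjects (BTemp (C.temperedArithmeticGroup e).Pi)).ι) ∧
        ∀ (σ : P.pre R.BN.base) (τ : autPre (qSub D C.Huu) (ιTheta D l) R.BN.base.obj),
          Functor.mapAut R.BN.base (connectedObjects (BTemp (C.temperedArithmeticGroup e).Pi)).ι σ.1 = τ.1 →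
            P.proj R.BN.base σ = autProj (qSub D C.Huu) (ιTheta D l) R.BN.base.obj τ := by
  refine (exists_thetaSubquotientProjGalois_pinned_ofThetaSettingDataQ μ hC hS h R K' constEmb constEmb_injective
    hinvc hinvp).imp fun P hP => ?_
  exact ⟨hP.1 R.BN.base, hP.2 R.BN.base⟩

end ThetaFrobenioid

end Literature.AnabelianGeometry.EtaleTheta

end
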